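import Literature.Analysis.FluidPDE.TorusLinearisedNSShearModesFourier
import Literature.Analysis.FunctionSpaces.TorusVectorParseval
import Literature.Analysis.FunctionSpaces.TorusFourierModes
import Literature.Analysis.FluidPDE.PassiveVector
import HarnessLib

/-!
# Linearised Navier–Stokes at a streamwise-invariant shear: superposition of streamwise modes is
# `L²`-ORTHOGONAL — energy bounds reduce to one streamwise harmonic at a time

Analysis/FluidPDE proofs-layer file (theorems only, NO definitions, NO `Prop` facts; D-0014/D-0026),
sequel of `TorusLinearisedNSShearModes` (linearity, translation covariance, rotation invariance of a
streamwise mode with its quadrature companion) and `TorusLinearisedNSShearModesFourier`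
(`Torus.linearisedNS_mFourierCoeff_eq_zero_of_streamwise_mode`: a single-mode datum stays in its mode).

## What is printed

For the Navier–Stokes (or Euler) equations linearised at a PARALLEL flow `U(y) eₓ` the coefficients do
not depend on the streamwise variable, so «it is possible to separate the variables … into normal modes
of the form `u′ = û(y) e^{i(kx − ωt)}`» (Drazin 2002, §8.1 (8.9)–(8.11)); the modes for different
streamwise wavenumbers `k` evolve independently and, by Parseval, are `L²`-orthogonal, so that an energy
bound for every single harmonic is an energy bound for their superposition (Schmid–Henningson's
«we may consider each wavenumber separately»; Bedrossian–Coti Zelati 2017 §1, projections `P_k` onto the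
`k`-th streamwise mode commute with the linearised operator, Thm 1.1 stated mode by mode).

## What is here (all proved; `d` arbitrary, axis `i`, viscosity `ν ≥ 0`, window `[a, b]`)

* `Torus.integral_inner_eq_zero_of_disjoint_fourierSupport`, `Torus.vectorL2Sq_add_of_disjoint_fourierSupport`:
  smooth real vector fields on `𝕋^d` with disjoint Fourier supports (at every frequency all components of
  one of them vanish) are `L²`-orthogonal; `‖v + w‖² = ‖v‖² + ‖w‖²` (Parseval,
  `Torus.hasSum_re_inner_mFourierCoeff_complexify`).
* `Torus.vectorL2Sq_finset_sum_of_streamwise_supports`: for a finite family `v l`, `l ∈ s ⊆ ℕ`, with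
  `𝓕((v l)ⱼ)(k) = 0` unless `kᵢ ∈ {l, −l}`: `‖Σ_l v l‖² = Σ_l ‖v l‖²`.
* `Torus.linearisedNS_add`, `Torus.linearisedNS_finset_sum`: sums of classical linearised solutions are
  classical linearised solutions (with the summed pressures) — the solution class is a vector space.
* **`Torus.linearisedNS_vectorL2Sq_finset_sum_eq`**: along a jointly smooth divergence-free background
  invariant under the translations of axis `i`, let `(w l, q l)` and companions `(w̃ l, q̃ l)`, `l ∈ s ⊆ ℕ`,
  be classical linearised solutions on `[a, b]` whose data form the streamwise mode `l` with its quadrature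
  companion (the hypotheses of `…_of_streamwise_mode`). Then at every `t ∈ [a, b]`
  `‖Σ_{l∈s} w l (t)‖²_{L²} = Σ_{l∈s} ‖w l (t)‖²_{L²}`.
* **`Torus.linearisedNS_vectorL2Sq_finset_sum_le_of_forall_mode`** (the REDUCTION): if moreover every mode
  obeys `‖w l (t)‖² ≤ K ‖w l (a)‖²`, then the superposition obeys `‖Σ w l (t)‖² ≤ K ‖Σ w l (a)‖²` — an
  `L²` growth bound for the linearised flow at a parallel shear on finite-bandwidth data is the worst
  single-harmonic bound (no cross terms, no constant lost); `Torus.linearisedNS_eq_finset_sum` (a solution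
  whose datum is the superposed datum IS the superposition, by `Torus.linearisedNS_unique`) and the packaged
  form **`Torus.linearisedNS_vectorL2Sq_le_of_datum_eq_finset_sum`** (`‖W(t)‖² ≤ K ‖W(a)‖²` for the GIVEN
  solution `W` with `W(a) = Σ w l (a)`).

Motivation (cell `ad-ideate`, route SawtoothPulseCascade, crux K2″ stmt-AnomalousDissipation-19696, line
`phase-cocycle`): after the parallel half pulse the state is a residual comb PERPENDICULAR to the running
pulse (support seat's `K2Classical.k2_injection_*_comb`, p470510), i.e. a superposition of streamwise
harmonics of the next (streamwise-invariant) pulse; this file reduces its `L²` envelope to one harmonic at a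
time for finite bandwidth.  The passage to infinite combs (all odd multiples of `N`) is by `L²`-stability of
the linearised flow (`TorusLinearisedNSShear`) and is NOT in this file.

## Mathlib / tree search

Tree (reused): `Torus.linearisedNS_mFourierCoeff_eq_zero_of_streamwise_mode` (p463588),
`Torus.linearisedNS_const_smul` / `Torus.linearisedNS_sub` (p463049), `Torus.hasSum_re_inner_mFourierCoeff_complexify`,
`Torus.mFourierCoeff_complexify_apply`, `Torus.IsSmooth.memLp/.integrable/.inner/.norm_sq`,
`Torus.IsSmoothSpaceTimeOn.add/.sub/.const_smul`, `Torus.divergence_sub`; `lean search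
'disjoint.*Fourier.*orthogon|vectorL2Sq_add|linearisedNS_add'`: nothing. Mathlib: `norm_add_sq_real`,
`HasSum.unique`, `Finset.sum_induction`.

## References

* P. G. Drazin, *Introduction to Hydrodynamic Stability*, CUP 2002, §8.1 (8.9)–(8.11) [held]. [`Drazin2002`]
* J. Bedrossian, M. Coti Zelati, Arch. Ration. Mech. Anal. 224 (2017) 1161–1204, §1 Thm 1.1 [held:
  arXiv:1510.08098]. [`BedrossianCotiZelati2017`]
* L. Grafakos, *Classical Fourier Analysis*, GTM 249 (2014), Prop. 3.2.7 (3) (Parseval on `𝕋ⁿ`). [`Grafakos2014`]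
-/

noncomputable section

open MeasureTheory Set Filter Function Complex UnitAddTorus
open scoped ContDiff InnerProductSpace RealInnerProductSpace Topology

namespace Literature.Analysis.FluidPDE

open Literature.Analysis.FunctionSpaces

variable {d : Type*} [Fintype d] [DecidableEq d]

/-! ### §1 Disjoint Fourier supports ⇒ `L²`-orthogonality (Parseval) -/

omit [DecidableEq d] in
/-- **Disjoint Fourier supports are `L²`-orthogonal.** If `v`, `w` are smooth real vector fields on `𝕋^d`
and at every frequency `k` all components of `𝓕v(k)` or all components of `𝓕w(k)` vanish, then
`∫ ⟪v, w⟫ = 0` (Parseval in the polarised form `∫⟪v,w⟫ = Σ_k Re⟪𝓕v(k), 𝓕w(k)⟫`).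
[cite: Grafakos2014, Prop. 3.2.7 (3)] -/
theorem Torus.integral_inner_eq_zero_of_disjoint_fourierSupport
    {v w : UnitAddTorus d → EuclideanSpace ℝ d} (hv : Torus.IsSmooth v) (hw : Torus.IsSmooth w)
    (h : ∀ k : d → ℤ, (∀ j, mFourierCoeff (fun x => ((v x j : ℝ) : ℂ)) k = 0) ∨
      (∀ j, mFourierCoeff (fun x => ((w x j : ℝ) : ℂ)) k = 0)) :
    ∫ x, ⟪v x, w x⟫_ℝ = 0 := by
  have hP := Torus.hasSum_re_inner_mFourierCoeff_complexify (hv.memLp 2) (hw.memLp 2)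
  have hzero : (fun k : d → ℤ => (inner ℂ (mFourierCoeff (EuclideanSpace.complexify ∘ v) k)
      (mFourierCoeff (EuclideanSpace.complexify ∘ w) k)).re) = fun _ => 0 := by
    funext k
    rcases h k with hk | hk
    · have hz : mFourierCoeff (EuclideanSpace.complexify ∘ v) k = 0 := by
        ext j
        rw [Torus.mFourierCoeff_complexify_apply hv.integrable k j, hk j]
        rfl
      rw [hz, inner_zero_left, Complex.zero_re]
    · have hz : mFourierCoeff (EuclideanSpace.complexify ∘ w) k = 0 := by
        ext j
        rw [Torus.mFourierCoeff_complexify_apply hw.integrable k j, hk j]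
        rfl
      rw [hz, inner_zero_right, Complex.zero_re]
  rw [hzero] at hP
  exact hP.unique hasSum_zero

omit [DecidableEq d] in
/-- **Pythagoras for disjoint Fourier supports**: `‖v + w‖²_{L²} = ‖v‖²_{L²} + ‖w‖²_{L²}`.
[cite: Grafakos2014, Prop. 3.2.7 (3)] -/
theorem Torus.vectorL2Sq_add_of_disjoint_fourierSupport
    {v w : UnitAddTorus d → EuclideanSpace ℝ d} (hv : Torus.IsSmooth v) (hw : Torus.IsSmooth w)
    (h : ∀ k : d → ℤ, (∀ j, mFourierCoeff (fun x => ((v x j : ℝ) : ℂ)) k = 0) ∨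
      (∀ j, mFourierCoeff (fun x => ((w x j : ℝ) : ℂ)) k = 0)) :
    Torus.vectorL2Sq (v + w) = Torus.vectorL2Sq v + Torus.vectorL2Sq w := by
  unfold Torus.vectorL2Sq
  have hpt : (fun x => ‖(v + w) x‖ ^ 2) = fun x => ‖v x‖ ^ 2 + 2 * ⟪v x, w x⟫_ℝ + ‖w x‖ ^ 2 := by
    funext x
    simp only [Pi.add_apply]
    exact norm_add_sq_real (v x) (w x)
  have i1 : Integrable (fun x => ‖v x‖ ^ 2) volume := hv.norm_sq.integrable
  have i2 : Integrable (fun x => 2 * ⟪v x, w x⟫_ℝ) volume := (hv.inner hw).integrable.const_mul 2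
  have i12 : Integrable (fun x => ‖v x‖ ^ 2 + 2 * ⟪v x, w x⟫_ℝ) volume := i1.add i2
  have i3 : Integrable (fun x => ‖w x‖ ^ 2) volume := hw.norm_sq.integrable
  rw [hpt, integral_add i12 i3, integral_add i1 i2, integral_const_mul,
    Torus.integral_inner_eq_zero_of_disjoint_fourierSupport hv hw h, mul_zero, add_zero]

omit [DecidableEq d] in
/-- Finite sums of smooth real vector fields on `𝕋^d` are smooth (real-scalar twin of
`Torus.isSmooth_finset_sum`). [folklore] -/
private theorem isSmooth_finset_sum_real {ι : Type*} (s : Finset ι)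
    {v : ι → UnitAddTorus d → EuclideanSpace ℝ d} (hv : ∀ l ∈ s, Torus.IsSmooth (v l)) :
    Torus.IsSmooth (fun x => ∑ l ∈ s, v l x) := by
  classical
  induction s using Finset.induction_on with
  | empty => simp only [Finset.sum_empty]; exact Torus.isSmooth_const _
  | @insert l₀ s hl₀ ih =>
    have h1 : (fun x => ∑ l ∈ insert l₀ s, v l x) = v l₀ + fun x => ∑ l ∈ s, v l x := by
      funext x; simp [Finset.sum_insert hl₀]
    rw [h1]
    exact (hv l₀ (Finset.mem_insert_self _ _)).add (ih fun l hl => hv l (Finset.mem_insert_of_mem hl))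

omit [DecidableEq d] in
/-- **Finite families with disjoint STREAMWISE supports.** If `v l`, `l ∈ s ⊆ ℕ`, are smooth real vector
fields on `𝕋^d` and the Fourier support of `v l` lies in the streamwise fibre `{k : kᵢ = l ∨ kᵢ = −l}`,
then `‖Σ_{l∈s} v l‖²_{L²} = Σ_{l∈s} ‖v l‖²_{L²}`. [cite: Grafakos2014, Prop. 3.2.7 (3)] -/
theorem Torus.vectorL2Sq_finset_sum_of_streamwise_supports {i : d} (s : Finset ℕ)
    {v : ℕ → UnitAddTorus d → EuclideanSpace ℝ d} (hv : ∀ l ∈ s, Torus.IsSmooth (v l))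
    (hsupp : ∀ l ∈ s, ∀ (j : d) (k : d → ℤ), k i ≠ (l : ℤ) → k i ≠ -(l : ℤ) →
      mFourierCoeff (fun x => ((v l x j : ℝ) : ℂ)) k = 0) :
    Torus.vectorL2Sq (fun x => ∑ l ∈ s, v l x) = ∑ l ∈ s, Torus.vectorL2Sq (v l) := by
  classical
  induction s using Finset.induction_on with
  | empty =>
    simp [Torus.vectorL2Sq]
  | @insert l₀ s hl₀ ih =>
    have hv' : ∀ l ∈ s, Torus.IsSmooth (v l) := fun l hl => hv l (Finset.mem_insert_of_mem hl)
    have hsupp' : ∀ l ∈ s, ∀ (j : d) (k : d → ℤ), k i ≠ (l : ℤ) → k i ≠ -(l : ℤ) →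
        mFourierCoeff (fun x => ((v l x j : ℝ) : ℂ)) k = 0 :=
      fun l hl => hsupp l (Finset.mem_insert_of_mem hl)
    have hS : Torus.IsSmooth (fun x => ∑ l ∈ s, v l x) := isSmooth_finset_sum_real s hv'
    have hsum : (fun x => ∑ l ∈ insert l₀ s, v l x) = v l₀ + fun x => ∑ l ∈ s, v l x := by
      funext x; simp [Finset.sum_insert hl₀]
    -- disjointness of the streamwise supports: `v l₀` lives on `kᵢ = ±l₀`, the partial sum on `kᵢ = ±l`, `l ≠ l₀`
    have hdisj : ∀ k : d → ℤ, (∀ j, mFourierCoeff (fun x => ((v l₀ x j : ℝ) : ℂ)) k = 0) ∨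
        (∀ j, mFourierCoeff (fun x => (((∑ l ∈ s, v l x) j : ℝ) : ℂ)) k = 0) := by
      intro k
      by_cases hk : k i = (l₀ : ℤ) ∨ k i = -(l₀ : ℤ)
      · right
        intro j
        have hcoe : (fun x => (((∑ l ∈ s, v l x) j : ℝ) : ℂ)) =
            fun x => ∑ l ∈ s, ((v l x j : ℝ) : ℂ) := by
          funext x
          rw [WithLp.ofLp_sum, Finset.sum_apply]
          push_cast
          rfl
        rw [hcoe, Torus.mFourierCoeff_finset_sum s (f := fun l x => ((v l x j : ℝ) : ℂ)) (fun l hl => by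
          exact (continuous_ofReal.comp ((hv' l hl).apply j).continuous).integrable_unitAddTorus)]
        refine Finset.sum_eq_zero fun l hl => ?_
        have hne : l ≠ l₀ := fun e => hl₀ (e ▸ hl)
        apply hsupp' l hl j k <;> omega
      · left
        push Not at hk
        exact fun j => hsupp l₀ (Finset.mem_insert_self _ _) j k hk.1 hk.2
    rw [hsum, Torus.vectorL2Sq_add_of_disjoint_fourierSupport (hv l₀ (Finset.mem_insert_self _ _)) hS hdisj,
      ih hv' hsupp', Finset.sum_insert hl₀]

/-! ### §2 The classical linearised solution class is a vector space -/

section Linear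

variable {a b ν : ℝ} {u : ℝ → UnitAddTorus d → EuclideanSpace ℝ d}

/-- Sums of smooth divergence-free fields are divergence free. [folklore] -/
private theorem isDivFree_add {v w : UnitAddTorus d → EuclideanSpace ℝ d} (hv : Torus.IsSmooth v)
    (hw : Torus.IsSmooth w) (hdv : Torus.IsDivFree v) (hdw : Torus.IsDivFree w) :
    Torus.IsDivFree (fun y => v y + w y) := by
  intro x
  have hfun : (fun y => v y + w y) = v - ((-1 : ℝ) • w) := by
    funext y; simp
  rw [hfun, Torus.divergence_sub (hv.isContDiff (by simp)) ((hw.smul (-1)).isContDiff (by simp)),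
    Torus.divergence_const_smul_of_isSmooth hw (-1) x, hdv x, hdw x]
  ring

/-- **Sums.** If `(w₁, q₁)` and `(w₂, q₂)` are classical solutions of the linearised Navier–Stokes system
along `u` on `[a, b]` then so is `(w₁ + w₂, q₁ + q₂)` (from `Torus.linearisedNS_sub` and
`Torus.linearisedNS_const_smul` with `c = −1`). [cite: Temam1997, Ch. VI §3.1 (3.7)-(3.10) (a linear problem)] -/
theorem Torus.linearisedNS_add (hab : a < b) {w₁ w₂ : ℝ → UnitAddTorus d → EuclideanSpace ℝ d}
    {q₁ q₂ : ℝ → UnitAddTorus d → ℝ}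
    (hw₁ : Torus.IsSmoothSpaceTimeOn (Icc a b) w₁) (hq₁ : Torus.IsSmoothSpaceTimeOn (Icc a b) q₁)
    (hlin₁ : ∀ t ∈ Icc a b, ∀ x, Torus.timeDerivWithin (Icc a b) w₁ t x + Torus.convect (u t) (w₁ t) x +
      Torus.convect (w₁ t) (u t) x = ν • Torus.laplacian (w₁ t) x - Torus.gradient (q₁ t) x)
    (hw₂ : Torus.IsSmoothSpaceTimeOn (Icc a b) w₂) (hq₂ : Torus.IsSmoothSpaceTimeOn (Icc a b) q₂)
    (hlin₂ : ∀ t ∈ Icc a b, ∀ x, Torus.timeDerivWithin (Icc a b) w₂ t x + Torus.convect (u t) (w₂ t) x +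
      Torus.convect (w₂ t) (u t) x = ν • Torus.laplacian (w₂ t) x - Torus.gradient (q₂ t) x)
    {t : ℝ} (ht : t ∈ Icc a b) (x : UnitAddTorus d) :
    Torus.timeDerivWithin (Icc a b) (fun s y => w₁ s y + w₂ s y) t x +
        Torus.convect (u t) (fun y => w₁ t y + w₂ t y) x + Torus.convect (fun y => w₁ t y + w₂ t y) (u t) x =
      ν • Torus.laplacian (fun y => w₁ t y + w₂ t y) x - Torus.gradient (fun y => q₁ t y + q₂ t y) x := by
  have hneg : ∀ s ∈ Icc a b, ∀ y,
      Torus.timeDerivWithin (Icc a b) (fun s y => (-1 : ℝ) • w₂ s y) s y +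
          Torus.convect (u s) (fun y => (-1 : ℝ) • w₂ s y) y + Torus.convect (fun y => (-1 : ℝ) • w₂ s y) (u s) y =
        ν • Torus.laplacian (fun y => (-1 : ℝ) • w₂ s y) y - Torus.gradient (fun y => (-1 : ℝ) • q₂ s y) y :=
    fun s hs y => Torus.linearisedNS_const_smul hab hw₂ hq₂ hlin₂ (-1) hs y
  have h := Torus.linearisedNS_sub hab hw₁ hq₁ hlin₁ (hw₂.const_smul (-1)) (hq₂.const_smul (-1)) hneg ht x
  have e1 : (fun s y => w₁ s y - (-1 : ℝ) • w₂ s y) = fun s y => w₁ s y + w₂ s y := by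
    funext s y; simp
  have e2 : (fun y => w₁ t y - (-1 : ℝ) • w₂ t y) = fun y => w₁ t y + w₂ t y := by
    funext y; simp
  have e3 : (fun y => q₁ t y - (-1 : ℝ) • q₂ t y) = fun y => q₁ t y + q₂ t y := by
    funext y; simp
  rw [e1, e2, e3] at h
  exact h

/-- **Finite sums** (over a nonempty index set) of classical linearised solutions along `u` on `[a, b]`
are classical linearised solutions: joint smoothness of `Σ w l`, `Σ q l`, divergence-freeness, and the
equation. [cite: Temam1997, Ch. VI §3.1 (3.7)-(3.10) (a linear problem)] -/
theorem Torus.linearisedNS_finset_sum (hab : a < b) {ι : Type*} {s : Finset ι} (hs : s.Nonempty)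
    {w : ι → ℝ → UnitAddTorus d → EuclideanSpace ℝ d} {q : ι → ℝ → UnitAddTorus d → ℝ}
    (hw : ∀ l ∈ s, Torus.IsSmoothSpaceTimeOn (Icc a b) (w l))
    (hq : ∀ l ∈ s, Torus.IsSmoothSpaceTimeOn (Icc a b) (q l))
    (hwdiv : ∀ l ∈ s, ∀ t ∈ Icc a b, Torus.IsDivFree (w l t))
    (hlin : ∀ l ∈ s, ∀ t ∈ Icc a b, ∀ x, Torus.timeDerivWithin (Icc a b) (w l) t x +
      Torus.convect (u t) (w l t) x + Torus.convect (w l t) (u t) x =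
        ν • Torus.laplacian (w l t) x - Torus.gradient (q l t) x) :
    Torus.IsSmoothSpaceTimeOn (Icc a b) (fun t y => ∑ l ∈ s, w l t y) ∧
      Torus.IsSmoothSpaceTimeOn (Icc a b) (fun t y => ∑ l ∈ s, q l t y) ∧
      (∀ t ∈ Icc a b, Torus.IsDivFree (fun y => ∑ l ∈ s, w l t y)) ∧
      (∀ t ∈ Icc a b, ∀ x, Torus.timeDerivWithin (Icc a b) (fun t y => ∑ l ∈ s, w l t y) t x +
        Torus.convect (u t) (fun y => ∑ l ∈ s, w l t y) x + Torus.convect (fun y => ∑ l ∈ s, w l t y) (u t) x =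
          ν • Torus.laplacian (fun y => ∑ l ∈ s, w l t y) x - Torus.gradient (fun y => ∑ l ∈ s, q l t y) x) := by
  classical
  induction hs using Finset.Nonempty.cons_induction with
  | singleton l₀ =>
    have e1 : (fun t y => ∑ l ∈ ({l₀} : Finset ι), w l t y) = w l₀ := by funext t y; simp
    have e2 : (fun t y => ∑ l ∈ ({l₀} : Finset ι), q l t y) = q l₀ := by funext t y; simp
    have e3 : ∀ t, (fun y => ∑ l ∈ ({l₀} : Finset ι), w l t y) = w l₀ t := fun t => by funext y; simp
    have e4 : ∀ t, (fun y => ∑ l ∈ ({l₀} : Finset ι), q l t y) = q l₀ t := fun t => by funext y; simp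
    simp only [e1, e2, e3, e4]
    exact ⟨hw l₀ (by simp), hq l₀ (by simp), hwdiv l₀ (by simp), hlin l₀ (by simp)⟩
  | cons l₀ s hl₀ hs ih =>
    have hw' : ∀ l ∈ s, Torus.IsSmoothSpaceTimeOn (Icc a b) (w l) := fun l hl => hw l (Finset.mem_cons_of_mem hl)
    have hq' : ∀ l ∈ s, Torus.IsSmoothSpaceTimeOn (Icc a b) (q l) := fun l hl => hq l (Finset.mem_cons_of_mem hl)
    have hwdiv' : ∀ l ∈ s, ∀ t ∈ Icc a b, Torus.IsDivFree (w l t) :=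
      fun l hl => hwdiv l (Finset.mem_cons_of_mem hl)
    have hlin' : ∀ l ∈ s, ∀ t ∈ Icc a b, ∀ x, Torus.timeDerivWithin (Icc a b) (w l) t x +
        Torus.convect (u t) (w l t) x + Torus.convect (w l t) (u t) x =
          ν • Torus.laplacian (w l t) x - Torus.gradient (q l t) x :=
      fun l hl => hlin l (Finset.mem_cons_of_mem hl)
    obtain ⟨H1, H2, H3, H4⟩ := ih hw' hq' hwdiv' hlin'
    have h0 : l₀ ∈ Finset.cons l₀ s hl₀ := Finset.mem_cons_self _ _
    have e1 : (fun t y => ∑ l ∈ Finset.cons l₀ s hl₀, w l t y) =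
        fun t y => w l₀ t y + ∑ l ∈ s, w l t y := by funext t y; rw [Finset.sum_cons]
    have e2 : (fun t y => ∑ l ∈ Finset.cons l₀ s hl₀, q l t y) =
        fun t y => q l₀ t y + ∑ l ∈ s, q l t y := by funext t y; rw [Finset.sum_cons]
    have e3 : ∀ t, (fun y => ∑ l ∈ Finset.cons l₀ s hl₀, w l t y) =
        fun y => w l₀ t y + ∑ l ∈ s, w l t y := fun t => by funext y; rw [Finset.sum_cons]
    have e4 : ∀ t, (fun y => ∑ l ∈ Finset.cons l₀ s hl₀, q l t y) =
        fun y => q l₀ t y + ∑ l ∈ s, q l t y := fun t => by funext y; rw [Finset.sum_cons]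
    simp only [e1, e2, e3, e4]
    refine ⟨(hw l₀ h0).add H1, (hq l₀ h0).add H2, fun t ht => ?_, fun t ht x => ?_⟩
    · exact isDivFree_add ((hw l₀ h0).isSmooth_slice ht) (H1.isSmooth_slice ht) (hwdiv l₀ h0 t ht) (H3 t ht)
    · exact Torus.linearisedNS_add hab (hw l₀ h0) (hq l₀ h0) (hlin l₀ h0) H1 H2 H4 ht x

end Linear

/-! ### §3 Superposition of streamwise modes along a streamwise-invariant background: the energy splits
mode by mode, and `L²` growth bounds reduce to one harmonic at a time -/

section Modes

variable {a b ν : ℝ} {i : d} {u : ℝ → UnitAddTorus d → EuclideanSpace ℝ d}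

/-- **The energy of a superposition of streamwise modes is the sum of the modal energies.** Along a
jointly smooth divergence-free background `u` on `[a, b] × 𝕋^d` invariant under the translations of the
`i`-th axis (`ν ≥ 0`), let `(w l, q l)` with quadrature companions `(w' l, q' l)`, `l ∈ s ⊆ ℕ`, be classical
linearised solutions whose data at time `a` form the streamwise mode `l`:
`w l (a, x + r eᵢ) = cos(2πlr) w l (a,x) − sin(2πlr) w' l (a,x)`, `w' l (a, x + r eᵢ) = sin(2πlr) w l (a,x) + cos(2πlr) w' l (a,x)`.
Then `‖Σ_{l∈s} w l (t)‖²_{L²} = Σ_{l∈s} ‖w l (t)‖²_{L²}` for every `t ∈ [a, b]` (each response stays in its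
streamwise fibre `kᵢ = ±l`, `Torus.linearisedNS_mFourierCoeff_eq_zero_of_streamwise_mode`, and distinct fibres
are `L²`-orthogonal). [cite: Drazin2002, §8.1 (8.9)-(8.11) (normal modes in x of the linearised problem at a parallel flow)] [cite: BedrossianCotiZelati2017, §1 Thm 1.1 (mode-by-mode statement, projections P_k)] -/
theorem Torus.linearisedNS_vectorL2Sq_finset_sum_eq (hν : 0 ≤ ν) (hab : a < b)
    (hu : Torus.IsSmoothSpaceTimeOn (Icc a b) u) (hudiv : ∀ t ∈ Icc a b, Torus.IsDivFree (u t))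
    (hinv : ∀ t ∈ Icc a b, ∀ (c : UnitAddCircle) (x : UnitAddTorus d), u t (x + Pi.single i c) = u t x)
    (s : Finset ℕ) {w w' : ℕ → ℝ → UnitAddTorus d → EuclideanSpace ℝ d}
    {q q' : ℕ → ℝ → UnitAddTorus d → ℝ}
    (hw : ∀ l ∈ s, Torus.IsSmoothSpaceTimeOn (Icc a b) (w l))
    (hq : ∀ l ∈ s, Torus.IsSmoothSpaceTimeOn (Icc a b) (q l))
    (hwdiv : ∀ l ∈ s, ∀ t ∈ Icc a b, Torus.IsDivFree (w l t))
    (hlin : ∀ l ∈ s, ∀ t ∈ Icc a b, ∀ x, Torus.timeDerivWithin (Icc a b) (w l) t x +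
      Torus.convect (u t) (w l t) x + Torus.convect (w l t) (u t) x =
        ν • Torus.laplacian (w l t) x - Torus.gradient (q l t) x)
    (hw' : ∀ l ∈ s, Torus.IsSmoothSpaceTimeOn (Icc a b) (w' l))
    (hq' : ∀ l ∈ s, Torus.IsSmoothSpaceTimeOn (Icc a b) (q' l))
    (hwdiv' : ∀ l ∈ s, ∀ t ∈ Icc a b, Torus.IsDivFree (w' l t))
    (hlin' : ∀ l ∈ s, ∀ t ∈ Icc a b, ∀ x, Torus.timeDerivWithin (Icc a b) (w' l) t x +
      Torus.convect (u t) (w' l t) x + Torus.convect (w' l t) (u t) x =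
        ν • Torus.laplacian (w' l t) x - Torus.gradient (q' l t) x)
    (h₁ : ∀ l ∈ s, ∀ (r : ℝ) (x : UnitAddTorus d), w l a (x + Pi.single i ((r : ℝ) : UnitAddCircle)) =
      Real.cos (2 * Real.pi * l * r) • w l a x - Real.sin (2 * Real.pi * l * r) • w' l a x)
    (h₂ : ∀ l ∈ s, ∀ (r : ℝ) (x : UnitAddTorus d), w' l a (x + Pi.single i ((r : ℝ) : UnitAddCircle)) =
      Real.sin (2 * Real.pi * l * r) • w l a x + Real.cos (2 * Real.pi * l * r) • w' l a x)
    {t : ℝ} (ht : t ∈ Icc a b) :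
    Torus.vectorL2Sq (fun x => ∑ l ∈ s, w l t x) = ∑ l ∈ s, Torus.vectorL2Sq (w l t) := by
  refine Torus.vectorL2Sq_finset_sum_of_streamwise_supports (i := i) s
    (fun l hl => (hw l hl).isSmooth_slice ht) ?_
  intro l hl j k hk hk'
  have e₁ : ∀ (r : ℝ) (x : UnitAddTorus d), w l a (x + Pi.single i ((r : ℝ) : UnitAddCircle)) =
      Real.cos (2 * Real.pi * (l : ℤ) * r) • w l a x - Real.sin (2 * Real.pi * (l : ℤ) * r) • w' l a x := by
    simpa [Int.cast_natCast] using h₁ l hl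
  have e₂ : ∀ (r : ℝ) (x : UnitAddTorus d), w' l a (x + Pi.single i ((r : ℝ) : UnitAddCircle)) =
      Real.sin (2 * Real.pi * (l : ℤ) * r) • w l a x + Real.cos (2 * Real.pi * (l : ℤ) * r) • w' l a x := by
    simpa [Int.cast_natCast] using h₂ l hl
  exact (Torus.linearisedNS_mFourierCoeff_eq_zero_of_streamwise_mode hν hab hu hudiv hinv (hw l hl) (hq l hl)
    (hwdiv l hl) (hlin l hl) (hw' l hl) (hq' l hl) (hwdiv' l hl) (hlin' l hl) (l : ℤ) e₁ e₂ ht j hk hk').1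

/-- **THE REDUCTION TO ONE STREAMWISE HARMONIC.** In the situation of
`Torus.linearisedNS_vectorL2Sq_finset_sum_eq`, if every mode obeys the `L²` bound
`‖w l (t)‖² ≤ K ‖w l (a)‖²` at some `t ∈ [a, b]`, then so does their superposition:
`‖Σ_{l∈s} w l (t)‖² ≤ K ‖Σ_{l∈s} w l (a)‖²` — no cross terms and no loss in the constant. So an `L²`
growth bound for the Navier–Stokes equations linearised at a streamwise-invariant shear, on data of
finite streamwise bandwidth, is the worst single-harmonic (Orr–Sommerfeld initial-value) bound.
[cite: Drazin2002, §8.1 (8.9)-(8.11) (normal modes in x of the linearised problem at a parallel flow)] [cite: BedrossianCotiZelati2017, §1 Thm 1.1 (mode-by-mode statement, projections P_k)] -/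
theorem Torus.linearisedNS_vectorL2Sq_finset_sum_le_of_forall_mode (hν : 0 ≤ ν) (hab : a < b)
    (hu : Torus.IsSmoothSpaceTimeOn (Icc a b) u) (hudiv : ∀ t ∈ Icc a b, Torus.IsDivFree (u t))
    (hinv : ∀ t ∈ Icc a b, ∀ (c : UnitAddCircle) (x : UnitAddTorus d), u t (x + Pi.single i c) = u t x)
    (s : Finset ℕ) {w w' : ℕ → ℝ → UnitAddTorus d → EuclideanSpace ℝ d}
    {q q' : ℕ → ℝ → UnitAddTorus d → ℝ}
    (hw : ∀ l ∈ s, Torus.IsSmoothSpaceTimeOn (Icc a b) (w l))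
    (hq : ∀ l ∈ s, Torus.IsSmoothSpaceTimeOn (Icc a b) (q l))
    (hwdiv : ∀ l ∈ s, ∀ t ∈ Icc a b, Torus.IsDivFree (w l t))
    (hlin : ∀ l ∈ s, ∀ t ∈ Icc a b, ∀ x, Torus.timeDerivWithin (Icc a b) (w l) t x +
      Torus.convect (u t) (w l t) x + Torus.convect (w l t) (u t) x =
        ν • Torus.laplacian (w l t) x - Torus.gradient (q l t) x)
    (hw' : ∀ l ∈ s, Torus.IsSmoothSpaceTimeOn (Icc a b) (w' l))
    (hq' : ∀ l ∈ s, Torus.IsSmoothSpaceTimeOn (Icc a b) (q' l))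
    (hwdiv' : ∀ l ∈ s, ∀ t ∈ Icc a b, Torus.IsDivFree (w' l t))
    (hlin' : ∀ l ∈ s, ∀ t ∈ Icc a b, ∀ x, Torus.timeDerivWithin (Icc a b) (w' l) t x +
      Torus.convect (u t) (w' l t) x + Torus.convect (w' l t) (u t) x =
        ν • Torus.laplacian (w' l t) x - Torus.gradient (q' l t) x)
    (h₁ : ∀ l ∈ s, ∀ (r : ℝ) (x : UnitAddTorus d), w l a (x + Pi.single i ((r : ℝ) : UnitAddCircle)) =
      Real.cos (2 * Real.pi * l * r) • w l a x - Real.sin (2 * Real.pi * l * r) • w' l a x)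
    (h₂ : ∀ l ∈ s, ∀ (r : ℝ) (x : UnitAddTorus d), w' l a (x + Pi.single i ((r : ℝ) : UnitAddCircle)) =
      Real.sin (2 * Real.pi * l * r) • w l a x + Real.cos (2 * Real.pi * l * r) • w' l a x)
    {K t : ℝ} (ht : t ∈ Icc a b)
    (hK : ∀ l ∈ s, Torus.vectorL2Sq (w l t) ≤ K * Torus.vectorL2Sq (w l a)) :
    Torus.vectorL2Sq (fun x => ∑ l ∈ s, w l t x) ≤ K * Torus.vectorL2Sq (fun x => ∑ l ∈ s, w l a x) := by
  have ha : a ∈ Icc a b := left_mem_Icc.2 hab.le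
  rw [Torus.linearisedNS_vectorL2Sq_finset_sum_eq hν hab hu hudiv hinv s hw hq hwdiv hlin hw' hq' hwdiv' hlin'
      h₁ h₂ ht,
    Torus.linearisedNS_vectorL2Sq_finset_sum_eq hν hab hu hudiv hinv s hw hq hwdiv hlin hw' hq' hwdiv' hlin'
      h₁ h₂ ha, Finset.mul_sum]
  exact Finset.sum_le_sum hK

/-- **Identification by uniqueness.** A classical linearised solution `(W, Q)` on `[a, b]` whose datum is
the superposition `Σ_{l∈s} w l (a)` of the data of classical solutions `(w l, q l)` (nonempty finite `s`)
IS the superposition: `W(t) = Σ_{l∈s} w l (t)` on `[a, b]` (`Torus.linearisedNS_finset_sum` +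
`Torus.linearisedNS_unique`). [cite: Temam1997, Ch. VI §3.1 (3.11) (the linearised problem possesses a unique solution)] -/
theorem Torus.linearisedNS_eq_finset_sum (hν : 0 ≤ ν) (hab : a < b)
    (hu : Torus.IsSmoothSpaceTimeOn (Icc a b) u) (hudiv : ∀ t ∈ Icc a b, Torus.IsDivFree (u t))
    {ι : Type*} {s : Finset ι} (hs : s.Nonempty)
    {w : ι → ℝ → UnitAddTorus d → EuclideanSpace ℝ d} {q : ι → ℝ → UnitAddTorus d → ℝ}
    (hw : ∀ l ∈ s, Torus.IsSmoothSpaceTimeOn (Icc a b) (w l))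
    (hq : ∀ l ∈ s, Torus.IsSmoothSpaceTimeOn (Icc a b) (q l))
    (hwdiv : ∀ l ∈ s, ∀ t ∈ Icc a b, Torus.IsDivFree (w l t))
    (hlin : ∀ l ∈ s, ∀ t ∈ Icc a b, ∀ x, Torus.timeDerivWithin (Icc a b) (w l) t x +
      Torus.convect (u t) (w l t) x + Torus.convect (w l t) (u t) x =
        ν • Torus.laplacian (w l t) x - Torus.gradient (q l t) x)
    {W : ℝ → UnitAddTorus d → EuclideanSpace ℝ d} {Q : ℝ → UnitAddTorus d → ℝ}
    (hW : Torus.IsSmoothSpaceTimeOn (Icc a b) W) (hQ : Torus.IsSmoothSpaceTimeOn (Icc a b) Q)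
    (hWdiv : ∀ t ∈ Icc a b, Torus.IsDivFree (W t))
    (hWlin : ∀ t ∈ Icc a b, ∀ x, Torus.timeDerivWithin (Icc a b) W t x + Torus.convect (u t) (W t) x +
      Torus.convect (W t) (u t) x = ν • Torus.laplacian (W t) x - Torus.gradient (Q t) x)
    (h0 : W a = fun x => ∑ l ∈ s, w l a x) {t : ℝ} (ht : t ∈ Icc a b) :
    W t = fun x => ∑ l ∈ s, w l t x := by
  obtain ⟨H1, H2, H3, H4⟩ := Torus.linearisedNS_finset_sum hab hs hw hq hwdiv hlin
  exact Torus.linearisedNS_unique hν hu hudiv hW hQ hWdiv hWlin H1 H2 H3 H4 h0 ht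

/-- **The reduction, stated for the given solution.** In the situation of
`Torus.linearisedNS_vectorL2Sq_finset_sum_eq` (modes `w l` with companions `w' l`, `l ∈ s ⊆ ℕ`, `s`
nonempty), a classical linearised solution `(W, Q)` with datum `W(a) = Σ_{l∈s} w l (a)` obeys
`‖W(t)‖²_{L²} ≤ K ‖W(a)‖²_{L²}` as soon as every mode obeys `‖w l (t)‖² ≤ K ‖w l (a)‖²`.
[cite: Drazin2002, §8.1 (8.9)-(8.11) (normal modes in x of the linearised problem at a parallel flow)] [cite: BedrossianCotiZelati2017, §1 Thm 1.1 (mode-by-mode statement, projections P_k)] -/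
theorem Torus.linearisedNS_vectorL2Sq_le_of_datum_eq_finset_sum (hν : 0 ≤ ν) (hab : a < b)
    (hu : Torus.IsSmoothSpaceTimeOn (Icc a b) u) (hudiv : ∀ t ∈ Icc a b, Torus.IsDivFree (u t))
    (hinv : ∀ t ∈ Icc a b, ∀ (c : UnitAddCircle) (x : UnitAddTorus d), u t (x + Pi.single i c) = u t x)
    {s : Finset ℕ} (hs : s.Nonempty) {w w' : ℕ → ℝ → UnitAddTorus d → EuclideanSpace ℝ d}
    {q q' : ℕ → ℝ → UnitAddTorus d → ℝ}
    (hw : ∀ l ∈ s, Torus.IsSmoothSpaceTimeOn (Icc a b) (w l))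
    (hq : ∀ l ∈ s, Torus.IsSmoothSpaceTimeOn (Icc a b) (q l))
    (hwdiv : ∀ l ∈ s, ∀ t ∈ Icc a b, Torus.IsDivFree (w l t))
    (hlin : ∀ l ∈ s, ∀ t ∈ Icc a b, ∀ x, Torus.timeDerivWithin (Icc a b) (w l) t x +
      Torus.convect (u t) (w l t) x + Torus.convect (w l t) (u t) x =
        ν • Torus.laplacian (w l t) x - Torus.gradient (q l t) x)
    (hw' : ∀ l ∈ s, Torus.IsSmoothSpaceTimeOn (Icc a b) (w' l))
    (hq' : ∀ l ∈ s, Torus.IsSmoothSpaceTimeOn (Icc a b) (q' l))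
    (hwdiv' : ∀ l ∈ s, ∀ t ∈ Icc a b, Torus.IsDivFree (w' l t))
    (hlin' : ∀ l ∈ s, ∀ t ∈ Icc a b, ∀ x, Torus.timeDerivWithin (Icc a b) (w' l) t x +
      Torus.convect (u t) (w' l t) x + Torus.convect (w' l t) (u t) x =
        ν • Torus.laplacian (w' l t) x - Torus.gradient (q' l t) x)
    (h₁ : ∀ l ∈ s, ∀ (r : ℝ) (x : UnitAddTorus d), w l a (x + Pi.single i ((r : ℝ) : UnitAddCircle)) =
      Real.cos (2 * Real.pi * l * r) • w l a x - Real.sin (2 * Real.pi * l * r) • w' l a x)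
    (h₂ : ∀ l ∈ s, ∀ (r : ℝ) (x : UnitAddTorus d), w' l a (x + Pi.single i ((r : ℝ) : UnitAddCircle)) =
      Real.sin (2 * Real.pi * l * r) • w l a x + Real.cos (2 * Real.pi * l * r) • w' l a x)
    {W : ℝ → UnitAddTorus d → EuclideanSpace ℝ d} {Q : ℝ → UnitAddTorus d → ℝ}
    (hW : Torus.IsSmoothSpaceTimeOn (Icc a b) W) (hQ : Torus.IsSmoothSpaceTimeOn (Icc a b) Q)
    (hWdiv : ∀ t ∈ Icc a b, Torus.IsDivFree (W t))
    (hWlin : ∀ t ∈ Icc a b, ∀ x, Torus.timeDerivWithin (Icc a b) W t x + Torus.convect (u t) (W t) x +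
      Torus.convect (W t) (u t) x = ν • Torus.laplacian (W t) x - Torus.gradient (Q t) x)
    (h0 : W a = fun x => ∑ l ∈ s, w l a x)
    {K t : ℝ} (ht : t ∈ Icc a b) (hK : ∀ l ∈ s, Torus.vectorL2Sq (w l t) ≤ K * Torus.vectorL2Sq (w l a)) :
    Torus.vectorL2Sq (W t) ≤ K * Torus.vectorL2Sq (W a) := by
  rw [Torus.linearisedNS_eq_finset_sum hν hab hu hudiv hs hw hq hwdiv hlin hW hQ hWdiv hWlin h0 ht, h0]
  exact Torus.linearisedNS_vectorL2Sq_finset_sum_le_of_forall_mode hν hab hu hudiv hinv s hw hq hwdiv hlin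
    hw' hq' hwdiv' hlin' h₁ h₂ ht hK

end Modes

end Literature.Analysis.FluidPDE

end
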